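import Literature.Probability.FitznerVanDerHofstad2017.Stage1CellsRem
import Literature.Probability.FitznerVanDerHofstad2017.Stage1EvalRec

/-!
# Literature.Probability.FitznerVanDerHofstad2017.Stage1FrameRem — the typed frame over the slotted recipe (N68g (g2), part 2a)

CITATION HEADER (PLACEMENT v2). Part of the certified REPRODUCTION of R. Fitzner, R. van der Hofstad, *Mean-field
behavior for nearest-neighbor percolation in d > 10*, EJP 22 (2017) no. 43 [FvdH17] and *Generalized approach to the
non-backtracking lace expansion*, PTRF 169 (2017) 1041–1119 [NoBLE17]; build `lace`, seat lean2 (gen 12); LEMMAS §20 node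
N68g part (g2) (REFEREE v41 R228 (2)).  ADDITIVE companion of `Stage1Frame.lean` / `Stage1EvalRec.lean` (nothing there is
changed; the binders of record are not touched); no numeral, no table, no verdict; nothing here is a cited fact.

WHAT.  `Stage1CellsRem` re-binds the record stage-1 recipe with the ten remainder reads of D55 as slots
`ρ : Fin 10 → T`.  This file carries the slots through the FRAME exactly as `Stage1Frame` / `Stage1EvalRec` build the
frame of record: the two derived atoms `Bound[G,{1},3,s]` (`Data.g13Rm ρ`, from `Rem.G13`) and `Bound[OpenBubble,1,s]`
(`Data.ob1Rm ρ`, from `Rem.openBubble`), the full valuation `Data.valRm ρ` (`mubOverMu[s] = 1/(1 − Bound[G,{1},3,s])`,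
`1/(1 − Bound[OpenBubble,1,s])` recomputed from the slotted cells) and evaluation `Data.evRm ρ`, the validity region
`Data.URm ρ`, the four product lower bounds and `mumin` (`…Rm ρ`, `K₂` with the PRINTED hexagon exponent as in the record,
D49), the sixty App. D inputs `Data.inpRm ρ` (field ↦ cell exactly as `Data.inpRec`), `Data.stage1Rm ρ`, `Data.frameRm ρ`
(texts copied mechanically from `Stage1Frame.lean` sha256 ea8c84e9d6158448… and `Stage1EvalRec.lean` sha256 f5a526a3768c735e…, cells from
`Stage1CellsRem.lean` sha256 a52b76224903a074…; generator `lean2/g12/g2/gen_frame_rem.py`).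

LITERAL REPRODUCTION (R228 (2)).  At `ρ := printSlots D.P` (the record's own atoms) everything is the record's:
`valRm_print`, `evRm_print`, `URm_print` (`↔`), `inpRm_print : D.inpRm (printSlots D.P) y s = D.inpRec y s`,
`stage1Rm_print`, `frameRm_print_S : (D.frameRm (printSlots D.P)).S = D.frameRec.S` — so the certified two-sided Stage-1
evaluation of record (`MeanFieldD11Stage1EvalRec`) IS the evaluation of the slotted frame at the record reads, with nothing
to re-validate.  The `Std` theorems (monotonicity / nonnegativity / `Frame.Hyp`) and the rational mirror for a table of
certified NBW caps at the slots are part 2b (same pattern as `Stage1EvalRec`; PX positivity needs no hypothesis on `ρ`).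

[cite: FitznerVanDerHofstad2017, notebook Percolation.nb cells 5, 10, 12, 36–37, 39, 44 (transcript l.237–241, 419–429, 1013–1055, 1214–1237)]
[cite: FitznerVanDerHofstad2016NoBLE, (5.23)–(5.27) and §5.3.2 p. 1097]
-/

namespace Literature.Probability.FitznerVanDerHofstad2017
namespace Stage1Cells

noncomputable section

open NoGoFrame F3Bounds BetaMap PX

namespace Data

variable {ν : Type*} (D : Data ν) (ρ : Fin 10 → T)

/-- (slotted copy, N68g (g2): remainder reads `ρ`) `Bound[G,{1},3,s]` (cell 5). [cite: FitznerVanDerHofstad2017, notebook Percolation.nb cell 5] -/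
def g13Rm (s : Pt) (y : State) : ℝ := D.ev0 s y (Rem.G13 D.P ρ)

/-- (slotted copy, N68g (g2): remainder reads `ρ`) `Bound[OpenBubble,1,s]` (cell 12). [cite: FitznerVanDerHofstad2017, notebook Percolation.nb cell 12] -/
def ob1Rm (s : Pt) (y : State) : ℝ := D.ev0 s y (Rem.openBubble D.P ρ 1 0)

/-- (slotted copy, N68g (g2): remainder reads `ρ`) The FULL valuation: the basic one extended by `Bound[G,{1},3,t]`, `mubOverMu[s] = 1/(1 − Bound[G,{1},3,s])` (cell 10),
`mubOverMu[i]`, and `1/(1 − Bound[OpenBubble,1,s])` (cell 39). [cite: FitznerVanDerHofstad2017, notebook Percolation.nb cells 10, 39] -/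
def valRm (s : Pt) (y : State) : Atom → ℝ
  | .G13at t => D.g13Rm ρ t y
  | .mubOverMu => 1 / (1 - D.g13Rm ρ s y)
  | .mubOverMuI => 1 / (1 - D.g13Rm ρ .i y)
  | .hdInv => 1 / (1 - D.ob1Rm ρ s y)
  | a => D.val0 s y a

/-- (slotted copy, N68g (g2): remainder reads `ρ`) evaluation of a cell at point `s` and state `y`. [folklore] -/
def evRm (s : Pt) (y : State) (e : T) : ℝ := e.eval (D.valRm ρ s y) (D.tabs.val D.P.d)

/-- (slotted copy, N68g (g2): remainder reads `ρ`) The stage-1 validity conditions AT ONE POINT: the two geometric ratios `< 1` and the five maximal bracket arguments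
of the product lower bounds of cells 36–37 `≤ 1` (they dominate the other four: `Data.brackets_le_one`). [folklore] -/
structure UAtRm (s : Pt) (y : State) : Prop where
  g13 : D.g13Rm ρ s y < 1
  ob1 : D.ob1Rm ρ s y < 1
  br3a : D.evRm ρ s y (Rem.pi1Br3a D.P ρ) ≤ 1
  br5a : D.evRm ρ s y (Rem.pi1Br5a D.P ρ) ≤ 1
  br5b : D.evRm ρ s y (Rem.pi1Br5b D.P ρ) ≤ 1
  brIIA : D.evRm ρ s y (Rem.PsiAlphaII01brA D.P ρ) ≤ 1
  brIIB : D.evRm ρ s y (Rem.PsiAlphaII01brB D.P ρ) ≤ 1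

/-- (slotted copy, N68g (g2): remainder reads `ρ`) The stage-1 VALIDITY REGION `U` of the typed frame: `UAt` at both points. [folklore] -/
def URm (y : State) : Prop := ∀ s, D.UAtRm ρ s y

/-- (slotted copy, N68g (g2): remainder reads `ρ`) Cell 36 with the printed exponent: `Bound[Pi,alpha,lower,0,s] = K₁ − piAlphaLowSub[s] + K₂rec (1 − piAlphaLowBr[s])`.
[cite: FitznerVanDerHofstad2017, notebook Percolation.nb cell 36 (transcript l.1013–1026); extended version arXiv:1506.07977v1 Lemma 5.3] -/
noncomputable def piAlphaLower0Rm (s : Pt) (y : State) : ℝ :=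
  D.K1 - D.evRm ρ s y (Rem.piAlphaLowSub D.P ρ) + D.K2rec * (1 - D.evRm ρ s y (Rem.piAlphaLowBr D.P ρ))

/-- (slotted copy, N68g (g2): remainder reads `ρ`) Cell 36: `Bound[Psi,lower,0,s] = K₁ − piAlphaLowSub[s] + (2d−2)² z_i⁴ (1 − psiLowBr1[s]) − 2d(2d−2) z_i⁴ ϑ[s]
+ K₃ (1 − psiLowBr2[s])`. [cite: FitznerVanDerHofstad2017, notebook Percolation.nb cell 36 (transcript l.1013–1026)] -/
def psiLower0Rm (s : Pt) (y : State) : ℝ :=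
  D.K1 - D.evRm ρ s y (Rem.piAlphaLowSub D.P ρ) + (2 * D.dR - 2) ^ 2 * D.zIr ^ 4 * (1 - D.evRm ρ s y (Rem.psiLowBr1 D.P ρ))
    - 2 * D.dR * (2 * D.dR - 2) * D.zIr ^ 4 * D.evRm ρ s y (vartheta D.P) + D.K3 * (1 - D.evRm ρ s y (Rem.psiLowBr2 D.P ρ))

/-- (slotted copy, N68g (g2): remainder reads `ρ`) Cell 36: `Bound[Pi,1,Lower,s] = (2d−1)(2d−2) z_i⁵ (1 − Br₀) − (2d−2) z_i⁵ (θ₄ + ϑ) + K₄ (1 − Br₃a)(1 − Br₃b)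
+ K₄ (1 − Br₄a)(1 − Br₄b) + K₅ (1 − Br₅a)(1 − Br₅b)`. [cite: FitznerVanDerHofstad2017, notebook Percolation.nb cell 36 (transcript l.1013–1026)] -/
def pi1LowerRm (s : Pt) (y : State) : ℝ :=
  (2 * D.dR - 1) * (2 * D.dR - 2) * D.zIr ^ 5 * (1 - D.evRm ρ s y (Rem.pi1Br0 D.P ρ))
    - (2 * D.dR - 2) * D.zIr ^ 5 * D.evRm ρ s y (Rem.pi1T2 D.P ρ)
    + D.K4 * ((1 - D.evRm ρ s y (Rem.pi1Br3a D.P ρ)) * (1 - D.evRm ρ s y (Rem.pi1Br3b D.P ρ)))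
    + D.K4 * ((1 - D.evRm ρ s y (Rem.pi1Br4a D.P ρ)) * (1 - D.evRm ρ s y (Rem.pi1Br4b D.P ρ)))
    + D.K5 * ((1 - D.evRm ρ s y (Rem.pi1Br5a D.P ρ)) * (1 - D.evRm ρ s y (Rem.pi1Br5b D.P ρ)))

/-- (slotted copy, N68g (g2): remainder reads `ρ`) Cell 37: `Bound[Psi,alphaI,0−1,AroundEi,s] = main[s] + coef · (1 − 2 (1 − brA[s])(1 − brB[s]))`. [cite: FitznerVanDerHofstad2017, notebook Percolation.nb cell 37 (transcript l.1035–1055)] -/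
def psiAlphaI01Rm (s : Pt) (y : State) : ℝ :=
  D.evRm ρ s y (Rem.PsiAlphaI01main D.P ρ)
    + D.evRm ρ s y (PsiAlphaI01coef D.P) * (1 - 2 * ((1 - D.evRm ρ s y (Rem.PsiAlphaI01brA D.P ρ)) * (1 - D.evRm ρ s y (Rem.PsiAlphaI01brB D.P ρ))))

/-- (slotted copy, N68g (g2): remainder reads `ρ`) Cell 37: `Bound[Psi,alphaII,0−1,AroundZero,s] = main[s] + coef[s] · (1 − (1 − brA[s])(1 − brB[s]))`. [cite: FitznerVanDerHofstad2017, notebook Percolation.nb cell 37 (transcript l.1035–1055)] -/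
def psiAlphaII01Rm (s : Pt) (y : State) : ℝ :=
  D.evRm ρ s y (Rem.PsiAlphaII01main D.P ρ)
    + D.evRm ρ s y (PsiAlphaII01coef D.P) * (1 - (1 - D.evRm ρ s y (Rem.PsiAlphaII01brA D.P ρ)) * (1 - D.evRm ρ s y (Rem.PsiAlphaII01brB D.P ρ)))

/-- (slotted copy, N68g (g2): remainder reads `ρ`) Cell 44: `mumin[s] = z[i] (1 − Max[Bound[G,{1},3,s], Bound[G,{1},3,i]])`. [cite: FitznerVanDerHofstad2017, notebook Percolation.nb cell 44 (transcript l.1214–1216)] -/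
def muMinRm (s : Pt) (y : State) : ℝ := D.zIr * (1 - max (D.g13Rm ρ s y) (D.g13Rm ρ .i y))

/-- (slotted copy, N68g (g2): remainder reads `ρ`) Cell 44 (l.1214–1237) ON THE CELLS OF RECORD: the sixty App. D inputs at point `s` and state `y`, field ↦ `Bound` key
exactly as `Data.inp` (tail-free variant `T″₀`), the 22 `Δ`-fields over `Stage1Cells.Rec` (D46 `wborbx` + D34 `wbg2`) and
`piAlphaLower` with the printed exponent (D49 `hexprint`). [cite: FitznerVanDerHofstad2017, notebook Percolation.nb cell 44 (transcript l.1214–1237)] -/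
noncomputable def inpRm (y : State) (s : Pt) : Inputs where
  mu := y.m
  muMin := D.muMinRm ρ s y
  mubOverMu := D.evRm ρ s y mubOverMu
  mub := D.evRm ρ s y z
  xiAlphaOneMinusZeroAtZero := 0
  xiAlphaZeroMinusOneAtZero := 0
  xiAlphaOneMinusZeroAtEi := D.evRm ρ s y (Rem.XiAlpha10 D.P ρ)
  xiAlphaZeroMinusOneAtEi := D.evRm ρ s y (Rem.XiAlpha01 D.P ρ)
  xiIotaAlphaIAtEi := D.evRm ρ s y (Rem.XiIotaAlphaI0 D.P ρ)
  xiIotaAlphaIIAtZero := D.evRm ρ s y XiIotaAlphaII0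
  xiIotaAlphaISumAroundEi := D.evRm ρ s y (Rem.XiIotaAlphaISum D.P ρ)
  xiIotaAlphaIISumAroundZero := D.evRm ρ s y (Rem.XiIotaAlphaIISum D.P ρ)
  psiAlphaIOneMinusZeroAroundEi := D.evRm ρ s y (Rem.PsiAlphaI10 D.P ρ)
  psiAlphaIIZeroMinusOneAroundZero := D.psiAlphaII01Rm ρ s y
  psiAlphaIZeroMinusOneAroundEi := D.psiAlphaI01Rm ρ s y
  psiAlphaIIOneMinusZeroAroundZero := D.evRm ρ s y (Rem.PsiAlphaII10 D.P ρ)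
  piAlpha := D.evRm ρ s y (Rem.PiAlpha0 D.P ρ)
  piAlphaLower := D.piAlphaLower0Rm ρ s y
  piOneLower := D.pi1LowerRm ρ s y
  psiZeroLower := D.psiLower0Rm ρ s y
  xiAbs := D.evRm ρ s y (Rem.XiAbs D.P ρ)
  xiOdd := D.evRm ρ s y (Rem.XiOdd D.P ρ)
  xiEven := D.evRm ρ s y (Rem.XiEven D.P ρ)
  xiEvenTail := D.evRm ρ s y (Rem.Xi2 D.P ρ)
  xiOddTail := D.evRm ρ s y (Rem.Xi3 D.P ρ)
  xiR0 := D.evRm ρ s y (Rem.XiR0 D.P ρ)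
  xiR1 := D.evRm ρ s y (Rem.XiR1 D.P ρ)
  xiR0Delta := D.evRm ρ s y (Rem.XiR0D D.P ρ)
  xiR1Delta := D.evRm ρ s y (Rem.XiR1D D.P ρ)
  xiDeltaAbs := D.evRm ρ s y (Rem.XiAbsD D.P ρ)
  xiOddDelta := D.evRm ρ s y (Rem.XiOddD D.P ρ)
  xiEvenDelta := D.evRm ρ s y (Rem.XiEvenD D.P ρ)
  xiOddTailDelta := D.evRm ρ s y (Rem.Xi3D D.P ρ)
  xiEvenTailDelta := D.evRm ρ s y (Rem.Xi2D D.P ρ)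
  psiRI0 := D.evRm ρ s y (Rem.PsiRI0 D.P ρ)
  psiRI1 := D.evRm ρ s y (Rem.PsiRI1 D.P ρ)
  psiRII0 := D.evRm ρ s y (Rem.PsiRII0 D.P ρ)
  psiRII1 := D.evRm ρ s y (Rem.PsiRII1 D.P ρ)
  psiRI0Delta := D.evRm ρ s y (Rem.PsiRI0D D.P ρ)
  psiRI1Delta := D.evRm ρ s y (Rem.PsiRI1D D.P ρ)
  psiRII0Delta := D.evRm ρ s y (Rem.PsiRII0D D.P ρ)
  psiRII1Delta := D.evRm ρ s y (Rem.PsiRII1D D.P ρ)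
  piR0 := D.evRm ρ s y (Rem.PiR0 D.P ρ)
  piR0DeltaEiEk := D.evRm ρ s y (Rem.PiR0D D.P ρ)
  xiIotaAbs := D.evRm ρ s y (Rem.XiIotaAbs D.P ρ)
  xiIotaOdd := D.evRm ρ s y (Rem.XiIotaOdd D.P ρ)
  xiIotaEven := D.evRm ρ s y (Rem.XiIotaEven D.P ρ)
  xiIotaEvenTail := D.evRm ρ s y (Rem.XiIota2 D.P ρ)
  xiIotaRI0 := D.evRm ρ s y (Rem.XiIotaRI0 D.P ρ)
  xiIotaRII0 := D.evRm ρ s y (Rem.XiIotaRII0 D.P ρ)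
  xiIotaDeltaEi := D.evRm ρ s y (Rem.XiIotaAbsDei D.P ρ)
  xiIotaOddDeltaEi := D.evRm ρ s y (Rem.XiIotaOddDei D.P ρ)
  xiIotaEvenDeltaEi := D.evRm ρ s y (Rem.XiIotaEvenDei D.P ρ)
  xiIotaEvenTailDeltaEi := D.evRm ρ s y (Rem.XiIota2Dei D.P ρ)
  xiIotaDeltaZero := D.evRm ρ s y (Rem.XiIotaAbsD0 D.P ρ)
  xiIotaOddDeltaZero := D.evRm ρ s y (Rem.XiIotaOddD0 D.P ρ)
  xiIotaEvenDeltaZero := D.evRm ρ s y (Rem.XiIotaEvenD0 D.P ρ)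
  xiIotaEvenTailDeltaZero := D.evRm ρ s y (Rem.XiIota2D0 D.P ρ)
  xiIotaRI0DeltaEi := D.evRm ρ s y (Rem.XiIotaRI0Dei D.P ρ)
  xiIotaRII0DeltaZero := D.evRm ρ s y (Rem.XiIotaRII0D0 D.P ρ)

/-- (slotted copy, N68g (g2): remainder reads `ρ`) STAGE 1 of the typed frame ON THE CELLS OF RECORD (the three two-point bounds are the coded cells 5, 6, 8, unchanged).
[cite: FitznerVanDerHofstad2017, notebook Percolation.nb cells 3–44] -/
noncomputable def stage1Rm (y : State) : Stage1 where
  inp := D.inpRm ρ y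
  G11 := D.evRm ρ .o y (Rem.G1 D.P ρ 1)
  G22 := D.evRm ρ .o y (G2 D.P 2)
  G012 := D.evRm ρ .o y (Rem.G01 D.P ρ 2)

/-- (slotted copy, N68g (g2): remainder reads `ρ`) THE TYPED FRAME ON THE CELLS OF RECORD: `Data.frame` with `S := D.stage1Rm ρ` (validity region `D.URm ρ`, initial cells,
`τ`, `n₀ … n₀₀₁` unchanged). [cite: FitznerVanDerHofstad2017, notebook Percolation.nb cells 2–54] -/
noncomputable def frameRm : Frame ν where
  d := D.dR
  τ := D.τ
  hasT203 := D.hasT203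
  codedD20 := D.codedD20
  codedD31 := D.codedD31
  codedD33 := D.codedD33
  printedD36 := D.printedD36
  n0 := D.n0
  n1 := D.n1
  n2 := D.n2
  n3 := D.n3
  n01 := D.n01
  n11 := D.n11
  n001 := D.n001
  S := D.stage1Rm ρ
  U := D.URm ρ

/-- The slotted frame's initial cells are `D.initCell`. [folklore] -/
theorem frameRm_initCell : (D.frameRm ρ).initCell = D.initCell := rfl

/-- Cell 44: `mu[s] = m` on the slotted frame. [folklore] -/
theorem mu_eq_rm (y : State) (s : Pt) : (((D.frameRm ρ).S y).inp s).mu = y.m := rfl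

/-! ## Literal reproduction at the record reads (R228 (2)): `ρ := printSlots D.P` gives back the frame of record -/

/-- at the record reads, `Bound[G,{1},3,s]` of the slotted recipe is the record's. [folklore] -/
@[simp] theorem g13Rm_print (s : Pt) (y : State) : D.g13Rm (printSlots D.P) s y = D.g13 s y := rfl

/-- at the record reads, `Bound[OpenBubble,1,s]` of the slotted recipe is the record's. [folklore] -/
@[simp] theorem ob1Rm_print (s : Pt) (y : State) : D.ob1Rm (printSlots D.P) s y = D.ob1 s y := rfl

/-- at the record reads, the full valuation of the slotted recipe is the record's. [folklore] -/
@[simp] theorem valRm_print (s : Pt) (y : State) : D.valRm (printSlots D.P) s y = D.val s y := by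
  funext a; cases a <;> rfl

/-- at the record reads, evaluation under the slotted valuation is evaluation of record. [folklore] -/
@[simp] theorem evRm_print (s : Pt) (y : State) (e : T) : D.evRm (printSlots D.P) s y e = D.ev s y e := by
  unfold evRm; rw [valRm_print]; rfl

/-- at the record reads, the slotted validity conditions at a point are the record's. [folklore] -/
theorem UAtRm_print (s : Pt) (y : State) : D.UAtRm (printSlots D.P) s y ↔ D.UAt s y := by
  constructor
  · rintro ⟨h1, h2, h3, h4, h5, h6, h7⟩
    exact ⟨h1, h2, by simpa using h3, by simpa using h4,
      by simpa using h5, by simpa using h6, by simpa using h7⟩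
  · rintro ⟨h1, h2, h3, h4, h5, h6, h7⟩
    exact ⟨h1, h2, by simpa using h3, by simpa using h4,
      by simpa using h5, by simpa using h6, by simpa using h7⟩

/-- at the record reads, the slotted validity region is the record's. [folklore] -/
theorem URm_print (y : State) : D.URm (printSlots D.P) y ↔ D.U y :=
  forall_congr' fun s => D.UAtRm_print s y

/-- at the record reads, `Bound[Pi,alpha,lower,0,s]` (printed exponent) of the slotted recipe is the record's. [folklore] -/
@[simp] theorem piAlphaLower0Rm_print (s : Pt) (y : State) : D.piAlphaLower0Rm (printSlots D.P) s y = D.piAlphaLower0Rec s y := by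
  simp [piAlphaLower0Rm, piAlphaLower0Rec]

/-- at the record reads, `Bound[Psi,lower,0,s]` of the slotted recipe is the record's. [folklore] -/
@[simp] theorem psiLower0Rm_print (s : Pt) (y : State) : D.psiLower0Rm (printSlots D.P) s y = D.psiLower0 s y := by
  simp [psiLower0Rm, psiLower0]

/-- at the record reads, `Bound[Pi,1,Lower,s]` of the slotted recipe is the record's. [folklore] -/
@[simp] theorem pi1LowerRm_print (s : Pt) (y : State) : D.pi1LowerRm (printSlots D.P) s y = D.pi1Lower s y := by
  simp [pi1LowerRm, pi1Lower]

/-- at the record reads, `Bound[Psi,alphaI,0−1,AroundEi,s]` of the slotted recipe is the record's. [folklore] -/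
@[simp] theorem psiAlphaI01Rm_print (s : Pt) (y : State) : D.psiAlphaI01Rm (printSlots D.P) s y = D.psiAlphaI01 s y := by
  simp [psiAlphaI01Rm, psiAlphaI01]

/-- at the record reads, `Bound[Psi,alphaII,0−1,AroundZero,s]` of the slotted recipe is the record's. [folklore] -/
@[simp] theorem psiAlphaII01Rm_print (s : Pt) (y : State) : D.psiAlphaII01Rm (printSlots D.P) s y = D.psiAlphaII01 s y := by
  simp [psiAlphaII01Rm, psiAlphaII01]

/-- at the record reads, `mumin[s]` of the slotted recipe is the record's. [folklore] -/
@[simp] theorem muMinRm_print (s : Pt) (y : State) : D.muMinRm (printSlots D.P) s y = D.muMin s y := rfl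

/-- LITERAL REPRODUCTION (R228 (2)): at the record reads the sixty App. D inputs of the slotted recipe ARE the inputs of
record `Data.inpRec` — hence their certified two-sided evaluation is `MeanFieldD11Stage1EvalRec` verbatim. [folklore] -/
@[simp] theorem inpRm_print (y : State) (s : Pt) : D.inpRm (printSlots D.P) y s = D.inpRec y s := by
  simp [inpRm, inpRec]

/-- (function form of `inpRm_print`) [folklore] -/
@[simp] theorem inpRm_print' : D.inpRm (printSlots D.P) = D.inpRec :=
  funext fun y => funext fun s => D.inpRm_print y s

/-- LITERAL REPRODUCTION (R228 (2)): at the record reads stage 1 of the slotted recipe IS stage 1 of record. [folklore] -/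
@[simp] theorem stage1Rm_print (y : State) : D.stage1Rm (printSlots D.P) y = D.stage1Rec y := by
  simp [stage1Rm, stage1Rec]

/-- LITERAL REPRODUCTION (R228 (2)), frame level: the stage-1 map of the slotted frame at the record reads is the record
frame's. [folklore] -/
theorem frameRm_print_S : (D.frameRm (printSlots D.P)).S = D.frameRec.S := funext D.stage1Rm_print

/-- … and its validity region is the record frame's. [folklore] -/
theorem frameRm_print_U (y : State) : (D.frameRm (printSlots D.P)).U y ↔ D.frameRec.U y := D.URm_print y

end Data

end

end Stage1Cells
end Literature.Probability.FitznerVanDerHofstad2017
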